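import Summits.SmoothPoincare4.SmoothPoincare4.Theorems.ConvexBisectionAcyclicBisectionExistsPrimitiveOrbitPair
import Summits.SmoothPoincare4.SmoothPoincare4.Theorems.ConvexBisectionAcyclicBisectionExistsKasCokernel
import HarnessLib

/-!
# Primitive vectors of `ℤ^{2g}` form one orbit under the transvections along the chain vectors
# and the `e_j` (wave 6, brick G6-2 of node N3a `node_STcurve` of stub `stub_STgeo` = NF4 N3, line
# `modp-braid-orbits`, crux `ConvexBisection.AcyclicBisectionExists`, item stmt-SmoothPoincare4-10508;
# registered sub-goal `helper_primitive_transvection_orbit`)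

**Theorem** (`orbit_chainVec_zero_of_isPrimitive`, registered `helper_primitive_transvection_orbit`).
For every `g` and every PRIMITIVE `v ∈ ℤ^{Fin g ⊕ Fin g}` (`IsPrimitive`,
`SignedHurwitzStabilisation.lean`) there is a finite sequence of signed transvections
`transvection (stdSymp ℤ g) (a, ±)` (`SignedHurwitzAction.lean`) along vectors `a` taken from

  `{chainVec g i | i < 2g} ∪ {e_j = Pi.single (inl j) 1 | j : Fin g}`

carrying `chainVec g 0 = e_0` to `v` (stated with `Relation.ReflTransGen` of the one-move relation,
so that no definition is introduced).  Since `chainVec g (2j+1) = f_j` and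
`chainVec g (2j+2) = e_{j+1} − e_j` (`LefschetzBaseHomologyRank.lean`), the moves include those
along `e_j, f_j` (an `SL(2, ℤ)` on each symplectic pair) and `e_{j+1} − e_j`; the proof is the
induction on `g` whose step is the two-pair kill of `…PrimitiveOrbitPair.lean` (the top pair of a
primitive vector of `ℤ^{2g+2}` is killed, the rest is a primitive vector of `ℤ^{2g}` embedded by
`embed g`, and moves at genus `g` embed as moves at genus `g + 1`), with base the Euclidean
algorithm on one pair.

Why the `e_j` are needed (corrected route to N3a): the `2g` CHAIN transvections alone generate the
image of the braid group `B_{2g+1}` (hyperelliptic involution!), which for `g ≥ 2` preserves the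
quadratic form `q(x) = Σ_j x_{e_j} x_{f_j} + Σ_j (j+1) x_{e_j} + Σ_j x_{f_j} (mod 2)` (`q = 1` on
every chain vector) and is therefore NOT transitive on primitive vectors (`q(e_1) = 0 ≠ 1 = q(e_0)`);
geometrically the extra generators are the Dehn twists along the lifts of loops around the first
`2j + 2` branch points (Humphries' non-chain generator for `j = 1`).  In the application, `R`-moves
are realised by page Dehn twists acting on shadows of embedded page curves (node N1a).

Contents: §1 inverse and integrality of transvections (`transvection_not_transvection_int`,
`isPrimitive_transvection`), §2 the embedding `ℤ^{2g} ↪ ℤ^{2g+2}` (`embed_transvection`,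
`embed_single_inl/inr`, `embed_chainVec`, `isPrimitive_of_embed`, `eq_embed_of_last_eq_zero`),
§3 the orbit relation (symmetry, closure under the five kinds of moves, transport along `embed`),
§4 the theorem.  Everything is proved; no definitions, no named facts, no `sorry`.
Reference: M. Newman, *Integral Matrices* (1972), Ch. VII; B. Farb, D. Margalit, *A primer on
mapping class groups* (2012), §4.4 (Humphries generators), §6.1. [folklore]
-/

noncomputable section

set_option linter.dupNamespace false

open Set Function
open Literature.Topology.FourManifolds Literature.Topology.FourManifolds.LefschetzBase
  Literature.GroupTheory.CombinatorialGroupTheory.SignedHurwitz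

namespace Summit.SmoothPoincare4.SmoothPoincare4.Theorems.AcyclicBisectionExists.ModpBraidOrbits

variable {g : ℕ}

/-! ## §1 Inverse and integrality of transvections -/

/-- **The transvection of the opposite sign is the inverse** (the pairing `stdSymp ℤ g` is
alternating; `transvection_not_transvection` of `…KasCokernel.lean`). [folklore] -/
theorem transvection_not_transvection_int (a x : Fin g ⊕ Fin g → ℤ) (s : Bool) :
    transvection (stdSymp ℤ g) (a, !s) (transvection (stdSymp ℤ g) (a, s) x) = x :=
  transvection_not_transvection (stdSymp ℤ g) (a, s) (stdSymp_int_self g a) x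

/-- A common divisor of the coordinates divides every pairing value. [folklore] -/
theorem dvd_stdSymp {d : ℤ} (a : Fin g ⊕ Fin g → ℤ) {x : Fin g ⊕ Fin g → ℤ} (hd : ∀ i, d ∣ x i) :
    d ∣ stdSymp ℤ g a x := by
  rw [stdSymp_int_apply]
  exact Finset.dvd_sum fun i _ => dvd_sub (dvd_mul_of_dvd_right (hd _) _) (dvd_mul_of_dvd_right (hd _) _)

/-- A common divisor of the coordinates of `x` divides the coordinates of any transvection of `x`.
[folklore] -/
theorem dvd_transvection_apply {d : ℤ} (a : Fin g ⊕ Fin g → ℤ) (s : Bool) {x : Fin g ⊕ Fin g → ℤ}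
    (hd : ∀ i, d ∣ x i) (i : Fin g ⊕ Fin g) : d ∣ transvection (stdSymp ℤ g) (a, s) x i := by
  rw [transvection_apply, Pi.add_apply, Pi.smul_apply, smul_eq_mul]
  exact dvd_add (hd i) (dvd_mul_of_dvd_left (dvd_mul_of_dvd_right (dvd_stdSymp a hd) _) _)

/-- **Transvections preserve primitivity.** [folklore] -/
theorem isPrimitive_transvection (a : Fin g ⊕ Fin g → ℤ) (s : Bool) {x : Fin g ⊕ Fin g → ℤ}
    (hx : IsPrimitive x) : IsPrimitive (transvection (stdSymp ℤ g) (a, s) x) := by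
  intro d hd
  refine hx d fun i => ?_
  rw [← transvection_not_transvection_int a x s]
  exact dvd_transvection_apply a (!s) hd i

/-- `ℤ^{Fin 0 ⊕ Fin 0}` has no primitive vector. [folklore] -/
theorem not_isPrimitive_zero_rank (v : Fin 0 ⊕ Fin 0 → ℤ) : ¬IsPrimitive v := fun hv =>
  not_isUnit_zero (hv 0 fun i => by rcases i with i | i <;> exact i.elim0)

/-! ## §2 The embedding `ℤ^{2g} ↪ ℤ^{2g+2}` -/

/-- `embed` is compatible with subtraction. [folklore] -/
theorem embed_sub (v w : Fin g ⊕ Fin g → ℤ) : embed g (v - w) = embed g v - embed g w := by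
  rw [← embedₗ_apply, map_sub, embedₗ_apply, embedₗ_apply]

/-- **Transvections embed**: `embed (T_a^s x) = T_{embed a}^s (embed x)`. [folklore] -/
theorem embed_transvection (a x : Fin g ⊕ Fin g → ℤ) (s : Bool) :
    embed g (transvection (stdSymp ℤ g) (a, s) x) =
      transvection (stdSymp ℤ (g + 1)) (embed g a, s) (embed g x) := by
  rw [transvection_apply, transvection_apply]
  dsimp only
  rw [embed_add, embed_smul, stdSymp_embed_embed]

/-- The last index is not an old index. [folklore] -/
theorem last_ne_castSucc' (j : Fin g) : Fin.last g ≠ j.castSucc := (Fin.castSucc_lt_last j).ne'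

/-- `embed e_j = e_j`. [folklore] -/
theorem embed_single_inl (j : Fin g) :
    embed g (Pi.single (Sum.inl j) 1) = Pi.single (Sum.inl j.castSucc) 1 := by
  ext i
  rcases i with i | i <;> induction i using Fin.lastCases <;>
    simp [Pi.single_apply, last_ne_castSucc', Fin.castSucc_inj]

/-- `embed f_j = f_j`. [folklore] -/
theorem embed_single_inr (j : Fin g) :
    embed g (Pi.single (Sum.inr j) 1) = Pi.single (Sum.inr j.castSucc) 1 := by
  ext i
  rcases i with i | i <;> induction i using Fin.lastCases <;>
    simp [Pi.single_apply, last_ne_castSucc', Fin.castSucc_inj]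

/-- **The chain embeds**: `embed (chainVec g i) = chainVec (g+1) i` for `i < 2g`. [folklore] -/
theorem embed_chainVec {i : ℕ} (hi : i < 2 * g) : embed g (chainVec g i) = chainVec (g + 1) i := by
  obtain ⟨j, rfl | rfl⟩ : ∃ j : ℕ, i = 2 * j ∨ i = 2 * j + 1 := ⟨i / 2, by omega⟩
  · have hj : j < g := by omega
    have h1 := chainVec_even g ⟨j, hj⟩
    have h2 := chainVec_even (g + 1) ⟨j, by omega⟩
    dsimp only at h1 h2
    rw [h1, h2, embed_sub, embed_single_inl]
    congr 1
    by_cases h0 : 0 < j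
    · rw [if_pos h0, if_pos h0, embed_single_inl]; rfl
    · rw [if_neg h0, if_neg h0, embed_zero]
  · have hj : j < g := by omega
    have h1 := chainVec_odd g ⟨j, hj⟩
    have h2 := chainVec_odd (g + 1) ⟨j, by omega⟩
    dsimp only at h1 h2
    rw [h1, h2, embed_single_inr]; rfl

/-- A vector is primitive if its embedding is. [folklore] -/
theorem isPrimitive_of_embed {y : Fin g ⊕ Fin g → ℤ} (h : IsPrimitive (embed g y)) : IsPrimitive y := by
  intro d hd
  refine h d fun i => ?_
  rcases i with i | i <;> induction i using Fin.lastCases <;> simp [hd]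

/-- A vector of `ℤ^{2g+2}` whose last pair vanishes is an embedded vector. [folklore] -/
theorem eq_embed_of_last_eq_zero {x : Fin (g + 1) ⊕ Fin (g + 1) → ℤ} (hl : x (Sum.inl (Fin.last g)) = 0)
    (hr : x (Sum.inr (Fin.last g)) = 0) :
    x = embed g (Sum.elim (fun j => x (Sum.inl j.castSucc)) (fun j => x (Sum.inr j.castSucc))) := by
  ext i
  rcases i with i | i <;> induction i using Fin.lastCases <;> simp [hl, hr]

/-! ## §3 The orbit relation: symmetry, the five kinds of moves, transport along `embed` -/

/-- One move is reversible, so the orbit relation is symmetric. [folklore] -/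
theorem orbit_symmetric {x y : Fin g ⊕ Fin g → ℤ} (h : Relation.ReflTransGen (fun x y : Fin g ⊕ Fin g → ℤ =>
    ∃ (a : Fin g ⊕ Fin g → ℤ) (s : Bool), ((∃ i : ℕ, i < 2 * g ∧ a = chainVec g i) ∨
      (∃ j : Fin g, a = Pi.single (Sum.inl j) 1)) ∧ y = transvection (stdSymp ℤ g) (a, s) x) x y) :
    Relation.ReflTransGen (fun x y : Fin g ⊕ Fin g → ℤ =>
      ∃ (a : Fin g ⊕ Fin g → ℤ) (s : Bool), ((∃ i : ℕ, i < 2 * g ∧ a = chainVec g i) ∨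
        (∃ j : Fin g, a = Pi.single (Sum.inl j) 1)) ∧ y = transvection (stdSymp ℤ g) (a, s) x) y x := by
  induction h with
  | refl => exact Relation.ReflTransGen.refl
  | tail _ hst ih =>
    obtain ⟨a, s, ha, rfl⟩ := hst
    exact Relation.ReflTransGen.head ⟨a, !s, ha, (transvection_not_transvection_int a _ s).symm⟩ ih

/-- The orbit relation is preserved by moves: primitivity along the orbit. [folklore] -/
theorem isPrimitive_of_orbit {x y : Fin g ⊕ Fin g → ℤ} (h : Relation.ReflTransGen (fun x y : Fin g ⊕ Fin g → ℤ =>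
    ∃ (a : Fin g ⊕ Fin g → ℤ) (s : Bool), ((∃ i : ℕ, i < 2 * g ∧ a = chainVec g i) ∨
      (∃ j : Fin g, a = Pi.single (Sum.inl j) 1)) ∧ y = transvection (stdSymp ℤ g) (a, s) x) x y)
    (hx : IsPrimitive x) : IsPrimitive y := by
  induction h with
  | refl => exact hx
  | tail _ hst ih =>
    obtain ⟨a, s, -, rfl⟩ := hst
    exact isPrimitive_transvection a s ih

/-- Move along `e_j`. [folklore] -/
theorem orbit_move_inl (j : Fin g) (x : Fin g ⊕ Fin g → ℤ) (s : Bool) :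
    Relation.ReflTransGen (fun x y : Fin g ⊕ Fin g → ℤ =>
      ∃ (a : Fin g ⊕ Fin g → ℤ) (s : Bool), ((∃ i : ℕ, i < 2 * g ∧ a = chainVec g i) ∨
        (∃ j : Fin g, a = Pi.single (Sum.inl j) 1)) ∧ y = transvection (stdSymp ℤ g) (a, s) x)
      x (transvection (stdSymp ℤ g) (Pi.single (Sum.inl j) 1, s) x) :=
  Relation.ReflTransGen.single ⟨_, s, Or.inr ⟨j, rfl⟩, rfl⟩

/-- Move along `f_j = chainVec g (2j+1)`. [folklore] -/
theorem orbit_move_inr (j : Fin g) (x : Fin g ⊕ Fin g → ℤ) (s : Bool) :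
    Relation.ReflTransGen (fun x y : Fin g ⊕ Fin g → ℤ =>
      ∃ (a : Fin g ⊕ Fin g → ℤ) (s : Bool), ((∃ i : ℕ, i < 2 * g ∧ a = chainVec g i) ∨
        (∃ j : Fin g, a = Pi.single (Sum.inl j) 1)) ∧ y = transvection (stdSymp ℤ g) (a, s) x)
      x (transvection (stdSymp ℤ g) (Pi.single (Sum.inr j) 1, s) x) := by
  rw [← chainVec_odd]
  exact Relation.ReflTransGen.single ⟨_, s, Or.inl ⟨2 * j + 1, by omega, rfl⟩, rfl⟩

/-- Move along `e_{j+1} − e_j = chainVec g (2j+2)`. [folklore] -/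
theorem orbit_move_sub {j : ℕ} (hj : j + 1 < g) (x : Fin g ⊕ Fin g → ℤ) (s : Bool) :
    Relation.ReflTransGen (fun x y : Fin g ⊕ Fin g → ℤ =>
      ∃ (a : Fin g ⊕ Fin g → ℤ) (s : Bool), ((∃ i : ℕ, i < 2 * g ∧ a = chainVec g i) ∨
        (∃ j : Fin g, a = Pi.single (Sum.inl j) 1)) ∧ y = transvection (stdSymp ℤ g) (a, s) x)
      x (transvection (stdSymp ℤ g)
        (Pi.single (Sum.inl (⟨j + 1, hj⟩ : Fin g)) 1 - Pi.single (Sum.inl (⟨j, by omega⟩ : Fin g)) 1, s) x) := by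
  have h := chainVec_even g ⟨j + 1, hj⟩
  dsimp only at h
  rw [if_pos (Nat.succ_pos j)] at h
  simp only [Nat.add_sub_cancel] at h
  rw [← h]
  exact Relation.ReflTransGen.single ⟨_, s, Or.inl ⟨2 * (j + 1), by omega, rfl⟩, rfl⟩

/-- **Transport along `embed`**: an orbit at genus `g` embeds as an orbit at genus `g + 1`.
[folklore] -/
theorem orbit_embed {x y : Fin g ⊕ Fin g → ℤ} (h : Relation.ReflTransGen (fun x y : Fin g ⊕ Fin g → ℤ =>
    ∃ (a : Fin g ⊕ Fin g → ℤ) (s : Bool), ((∃ i : ℕ, i < 2 * g ∧ a = chainVec g i) ∨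
      (∃ j : Fin g, a = Pi.single (Sum.inl j) 1)) ∧ y = transvection (stdSymp ℤ g) (a, s) x) x y) :
    Relation.ReflTransGen (fun x y : Fin (g + 1) ⊕ Fin (g + 1) → ℤ =>
      ∃ (a : Fin (g + 1) ⊕ Fin (g + 1) → ℤ) (s : Bool), ((∃ i : ℕ, i < 2 * (g + 1) ∧ a = chainVec (g + 1) i) ∨
        (∃ j : Fin (g + 1), a = Pi.single (Sum.inl j) 1)) ∧ y = transvection (stdSymp ℤ (g + 1)) (a, s) x)
      (embed g x) (embed g y) := by
  induction h with
  | refl => exact Relation.ReflTransGen.refl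
  | tail _ hst ih =>
    obtain ⟨a, s, ha, rfl⟩ := hst
    refine ih.tail ⟨embed g a, s, ?_, embed_transvection a _ s⟩
    rcases ha with ⟨i, hi, rfl⟩ | ⟨j, rfl⟩
    · exact Or.inl ⟨i, by omega, embed_chainVec hi⟩
    · exact Or.inr ⟨j.castSucc, embed_single_inl j⟩

/-! ## §4 The theorem -/

/-- The gcd of the pair of a primitive vector supported on one pair is `1`. [folklore] -/
theorem gcd_eq_one_of_isPrimitive {x : Fin 1 ⊕ Fin 1 → ℤ} (hx : IsPrimitive x) :
    Int.gcd (x (Sum.inl 0)) (x (Sum.inr 0)) = 1 := by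
  have hu := hx (Int.gcd (x (Sum.inl 0)) (x (Sum.inr 0))) fun i => by
    rcases i with i | i
    · rw [Fin.fin_one_eq_zero i]; exact Int.gcd_dvd_left _ _
    · rw [Fin.fin_one_eq_zero i]; exact Int.gcd_dvd_right _ _
  have h := Int.isUnit_iff_natAbs_eq.1 hu
  rwa [Int.natAbs_natCast] at h

/-- **Every primitive vector of `ℤ^{2g}` lies in the orbit of `chainVec g 0 = e_0` under the signed
transvections along the chain vectors and the `e_j`.**  Induction on `g`: the top pair of a
primitive vector of `ℤ^{2g+2}` is killed by the two-pair kill (`twoPair_kill`; for `g = 0` by the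
one-pair Euclidean algorithm `pair_euclid`, ending at `(1, 0) = e_0` by primitivity), the result is
`embed` of a primitive vector of `ℤ^{2g}`, which by induction is in the orbit of `chainVec g 0`,
and that orbit embeds (`orbit_embed`, `embed (chainVec g 0) = chainVec (g+1) 0`).
[cite: FarbMargalit2012, §6.1] -/
theorem orbit_chainVec_zero_of_isPrimitive :
    ∀ (g : ℕ) (v : Fin g ⊕ Fin g → ℤ), IsPrimitive v →
      Relation.ReflTransGen (fun x y : Fin g ⊕ Fin g → ℤ =>
        ∃ (a : Fin g ⊕ Fin g → ℤ) (s : Bool), ((∃ i : ℕ, i < 2 * g ∧ a = chainVec g i) ∨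
          (∃ j : Fin g, a = Pi.single (Sum.inl j) 1)) ∧ y = transvection (stdSymp ℤ g) (a, s) x)
        (chainVec g 0) v := by
  intro g
  induction g with
  | zero => exact fun v hv => (not_isPrimitive_zero_rank v hv).elim
  | succ g ih =>
    intro v hv
    rcases Nat.eq_zero_or_pos g with rfl | hg
    · -- genus one: the Euclidean algorithm on the single pair ends at `(1, 0) = e_0`
      obtain ⟨y, hy, hyl, hyr, -⟩ := pair_euclid (0 : Fin 1) (R := Relation.ReflTransGen _)
        (fun x => Relation.ReflTransGen.refl) (fun x y z => Relation.ReflTransGen.trans)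
        (orbit_move_inl 0) (orbit_move_inr 0) v
      have hyp : IsPrimitive y := isPrimitive_of_orbit hy hv
      have hy1 : y (Sum.inl 0) = 1 := by
        have h := gcd_eq_one_of_isPrimitive hyp
        rw [hyl, hyr, Int.gcd_zero_right, Int.natAbs_natCast] at h
        rw [hyl, h, Nat.cast_one]
      have hye : y = chainVec 1 0 := by
        have h0 : chainVec 1 0 = Pi.single (Sum.inl 0) 1 := by
          simpa using chainVec_even 1 0
        rw [h0]
        ext i
        rcases i with i | i <;> rw [Fin.fin_one_eq_zero i]
        · rw [hy1]; simp
        · rw [hyr]; simp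
      exact orbit_symmetric (hye ▸ hy)
    · -- genus `g + 1 ≥ 2`: kill the top pair, embed the induction hypothesis
      obtain ⟨g', rfl⟩ : ∃ g', g = g' + 1 := ⟨g - 1, by omega⟩
      have hne : (Fin.last (g' + 1)) ≠ ⟨g', by omega⟩ := fun h => by
        have := congrArg Fin.val h; simp at this
      obtain ⟨y, hy, hyl, hyr, -⟩ := twoPair_kill hne (R := Relation.ReflTransGen _)
        (fun x => Relation.ReflTransGen.refl) (fun x y z => Relation.ReflTransGen.trans)
        (orbit_move_inl _) (orbit_move_inr _) (orbit_move_inl _) (orbit_move_inr _)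
        (fun x s => orbit_move_sub (j := g') (by omega) x s) v
      have hyp : IsPrimitive y := isPrimitive_of_orbit hy hv
      set z : Fin (g' + 1) ⊕ Fin (g' + 1) → ℤ :=
        Sum.elim (fun j => y (Sum.inl j.castSucc)) (fun j => y (Sum.inr j.castSucc)) with hz
      have hyz : y = embed (g' + 1) z := eq_embed_of_last_eq_zero hyl hyr
      have hzp : IsPrimitive z := isPrimitive_of_embed (hyz ▸ hyp)
      have h1 := orbit_embed (ih z hzp)
      rw [embed_chainVec (by omega), ← hyz] at h1
      exact h1.trans (orbit_symmetric hy)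

/-- **Sub-goal `helper_primitive_transvection_orbit`** (G6-2, the corrected algebra of node N3a
`node_STcurve`): every primitive `v ∈ ℤ^{2g}` is reached from `chainVec g 0` by finitely many
signed transvections (for `stdSymp ℤ g`) along chain vectors `chainVec g i` (`i < 2g`) and
coordinate vectors `e_j = Pi.single (inl j) 1`. [cite: FarbMargalit2012, §6.1] -/
theorem helper_primitive_transvection_orbit : ∀ (g : ℕ) (v : Fin g ⊕ Fin g → ℤ), Literature.GroupTheory.CombinatorialGroupTheory.SignedHurwitz.IsPrimitive v → Relation.ReflTransGen (fun x y : Fin g ⊕ Fin g → ℤ => ∃ (a : Fin g ⊕ Fin g → ℤ) (s : Bool), ((∃ i : ℕ, i < 2 * g ∧ a = Literature.Topology.FourManifolds.LefschetzBase.chainVec g i) ∨ (∃ j : Fin g, a = Pi.single (Sum.inl j) 1)) ∧ y = Literature.GroupTheory.CombinatorialGroupTheory.SignedHurwitz.transvection (Literature.GroupTheory.CombinatorialGroupTheory.SignedHurwitz.stdSymp ℤ g) (a, s) x) (Literature.Topology.FourManifolds.LefschetzBase.chainVec g 0) v :=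
  orbit_chainVec_zero_of_isPrimitive

end Summit.SmoothPoincare4.SmoothPoincare4.Theorems.AcyclicBisectionExists.ModpBraidOrbits

end
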